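import Literature.Computability.Cryptography.RegevLWESolveGaussian
import Literature.Computability.Cryptography.RegevBDDToLWESampleFine
import Literature.Computability.Cryptography.RegevBDDIntegerNoise
import Literature.Algebra.EuclideanLattices.RegevDigitRecursion
import Literature.Algebra.EuclideanLattices.BabaiNearestPlane
import HarnessLib

/-!
# Regev 2009, Lemma 3.4 (= Peikert 2009, Prop. 3.2): the whole classical `BDD → LWE` reduction as one idealised experiment, and its success bound

Topic `Computability/Cryptography` (family `pqc`), grouping namespace `Regev2009`. Everything here is
PROVED (theorems, plus definitions WITH BODIES of the objects of the experiment); no named fact.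

**The statement being served.** Peikert's Prop. 3.2 (STOC 2009; = Regev 2009, Lemma 3.4 with `L ↔ L*`,
the second component `h₂` of `peikert_gapSVPZeta_to_lwe_classical_of_components`, pqc.S20): given a
basis `B` of `Λ`, `r ≥ √2·q·η_ε(Λ*)`, a target `x` within `αq/(√2 r)` of `Λ`, samples from `D_{Λ*,r}` and
an oracle for `LWE_{q,Ψ_α}`, find the lattice vector `κ` closest to `x`. Regev's algorithm (§3.2.1):
manufacture `LWE` samples with secret `s = B⁻¹κ mod q` (Lemma 3.11), find `s` with the oracle (Lemma 3.7:
unknown noise width `β ≤ α`, padded over a grid; Lemma 4.1's shift because the oracle is average-case;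
Lemma 3.6: verification), then (Lemma 3.5) pass to `x₁ = (x - B·s̃)/q`, whose closest vector
`κ₁ = (κ - B·s̃)/q ∈ Λ` is `q` times closer, and finish with Babai's nearest-plane algorithm (exact as
soon as the distance is below half the shortest Gram–Schmidt norm — ONE digit suffices in Peikert's
regime, where `dist(x, Λ)/q ≤ α/(√2 r)` while `minᵢ‖b̃ᵢ‖ ≥ ω(√(log n))/r`).

This file writes that algorithm as ONE `PMF` experiment — `regevBDD`: the data of `(K_g+1)·J` blocks
(uniform shift, `m` coarse manufactured samples with the padded Gaussian parameter of the block,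
`N_V` fine manufactured samples), read through `firstAccepted` (`RegevLWESolveIdealised.lean`) and the
deterministic digit/Babai step `digitOutput` — and PROVES

  `Pr[regevBDD ≠ some (B⁻¹κ)] ≤ (K_g+1)·J·(m + N_V)·(δ + 6ε) + (K_g+1)·J·η_A + 2^{-J}`

(`toReal_regevBDD_ne_le`; `δ` the statistical distance of the lattice sampler from `D_{Λ*,r}`, `ε` the
smoothing slack, `η_A` the false-acceptance bound of the verification test `Acc` — for Regev's cosine test
`η_A = e^{-N_V e^{-2πα²}/32}`, `toReal_regevBDD_ne_le_cos`), under the hypotheses of the printed lemmas. What a bit-level proof of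
`h₂` must still supply is only MACHINE work: a sampler for `D_{Λ*,r}` (GPV, the tree's
`tvDist_sampleLatticePMF_discreteGaussian_le`) and for the rounded Gaussian noise, exact rational
arithmetic for `⟨x, v⟩/q`, the roundings, the shift and Babai, the oracle I/O — plus the observation that
its output law is `regevBDD` up to the sampling errors — and the parameter schedule making the
right-hand side `≤ n^{-c}`.

## Objects (definitions with bodies)

* `digitOutput B q x s` — Lemma 3.5 with one digit: `q·NearestPlane_B((x - B s̃)/q) + s̃` (`s̃ᵢ = val sᵢ`).
* `padNoise α K_g J j` — the Gaussian parameter `√((α/√2)² + k_j α²/K_g)` of the coarse samples of block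
  `j = (k_j, i_j)` (Regev's `e` has parameter `α/√2`; the padding of Lemma 3.7 is folded in: a sum of
  independent Gaussians is Gaussian); `realBlockLaw`, `regevData` (the law of the data), `regevBDD`
  (parametrised by the acceptance family `Acc` of the verification test: Regev's is
  `acceptSet q K N_V θ_α` of `RegevVerificationTest.lean`; a machine evaluates a rounded cosine).

## Results

* `inner_coe_basis_eq_repr`, `secretOf_eq_of_biorth`, `coe_mem_dualLattice_of_biorth` — with `B^∨` the
  basis of `Λ*` dual to `B` (`⟪bᵢ, b^∨ⱼ⟫ = δᵢⱼ`), the secret of Lemma 3.11 is `B⁻¹κ mod q` and `Λ ⊆ (Λ*)*`.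
* `digitOutput_eq_repr` — **Lemma 3.5, one level + Babai**: if `‖x - κ‖/q < ‖b̃ᵢ‖/2` for all `i` then
  `digitOutput B q x (B⁻¹κ mod q) = B⁻¹κ` (tree: `Regev2009.coe_sub_eq_smul_and_repr`,
  `Babai.nearestPlane_vecOf_add_of_norm_lt`).
* `tvDist_prodLaw_le`, `tvDist_realBlockLaw_blockLaw_le`, `tvDist_regevData_le` — **the data is
  `(K_g+1)J(m+N_V)(δ+6ε)`-close to the ideal data** of `RegevLWESolveGaussian.lean` (Lemma 3.11 coarse and
  fine, `RegevBDDToLWESamples.lean` / `RegevBDDToLWESampleFine.lean`).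
* `bddLWESampleFineOf_eq_bind_floorGaussian` — the fine manufactured sample, too, is an exact integer
  function of `(v, ⌊L·e⌋)` (`L = qK·N`, `N` even, `N⟨x,v⟩ ∈ ℤ`; twin of the coarse statement in
  `RegevBDDIntegerNoise.lean`); hence `realBlockLawInt`, `regevDataInt` — the same laws written with the
  INTEGER noise samples `floorGaussian` — and `regevData_eq_regevDataInt`, `regevBDD_eq_map_regevDataInt`:
  every real-valued draw of `regevBDD` is removable; a machine with exact samplers for `D` and
  `floorGaussian` and exactly uniform shifts has output law `regevBDD` on the nose;
* `toReal_regevBDD_ne_le` — the displayed bound for any verification test with error bounds `(η_A, η_R)`,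
  `η_R ≤ 1/7`, valid for all fine laws `A^{(K)}_{s',Ψ̄_{β'}}`, `0 < β' ≤ α`; `toReal_regevBDD_ne_le_cos` —
  the instance with Regev's cosine test (`4πe^{πα²} ≤ qK`, `e^{-N_V e^{-2πα²}/128} ≤ 1/7`).

## References

* O. Regev, *On lattices, learning with errors, random linear codes, and cryptography*, J. ACM 56
  (2009), art. 34 = arXiv:2401.03703, §3.2.1: Lemmas 3.4, 3.5, 3.6, 3.7, 3.11, Lemma 4.1 (proof)
  [RegevLWE2009].
* C. Peikert, *Public-key cryptosystems from the worst-case shortest vector problem*, STOC 2009,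
  Prop. 3.2 and the proof of Thm. 3.1 [Peikert2009].
* L. Babai, *On Lovász' lattice reduction and the nearest lattice point problem*, Combinatorica 6 (1986),
  §3 [Babai1986].
-/

noncomputable section

open Finset Module MeasureTheory
open scoped ENNReal Real InnerProductSpace

namespace Literature.Computability.Cryptography

namespace Regev2009

open Literature.Probability.Distributions Literature.Probability.Moments LWE
  Literature.Algebra.EuclideanLattices Literature.Algebra.EuclideanLattices.GPVSampler
open Literature.Algebra.EuclideanLattices.Regev2009 (dvd_repr_sub_val coe_sub_eq_smul_and_repr
  inv_smul_sub_sub_eq)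

/-! ### Dual bases: the secret is `B⁻¹κ mod q` -/

section Biorth

variable {E : Type*} [NormedAddCommGroup E] [InnerProductSpace ℝ E]
variable {Λ L : Submodule ℤ E} {n : ℕ} (bΛ : Basis (Fin n) ℤ Λ) (bL : Basis (Fin n) ℤ L)

/-- With `B^∨` dual to `B` (`⟪bᵢ, b^∨ⱼ⟫ = δᵢⱼ`), `⟪κ, b^∨ᵢ⟫ = (B⁻¹κ)ᵢ` for `κ ∈ Λ`. [folklore] -/
theorem inner_coe_basis_eq_repr
    (hb : ∀ i j, ⟪((bΛ i : Λ) : E), ((bL j : L) : E)⟫_ℝ = if i = j then 1 else 0) (κ : Λ) (i : Fin n) :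
    ⟪(κ : E), ((bL i : L) : E)⟫_ℝ = bΛ.repr κ i := by
  conv_lhs => rw [← bΛ.sum_repr κ]
  rw [Submodule.coe_sum, sum_inner]
  simp_rw [Submodule.coe_smul_of_tower, ← Int.cast_smul_eq_zsmul ℝ, real_inner_smul_left, hb]
  simp

/-- **The secret of Lemma 3.11 is `B⁻¹κ mod q`** (Regev: "`s = (L*)⁻¹κ_{L*}(x) mod p`"; Peikert's
orientation `L = Λ*`, `L* = Λ`): `secretOf B^∨ q κ = (B⁻¹κ) mod q`. [cite: RegevLWE2009, Lemma 3.11 (proof)] -/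
theorem secretOf_eq_of_biorth (q : ℕ)
    (hb : ∀ i j, ⟪((bΛ i : Λ) : E), ((bL j : L) : E)⟫_ℝ = if i = j then 1 else 0) (κ : Λ) :
    secretOf bL q (κ : E) = fun i => ((bΛ.repr κ i : ℤ) : ZMod q) := by
  funext i
  rw [secretOf, inner_coe_basis_eq_repr bΛ bL hb κ i, round_intCast]

/-- `Λ ⊆ L*` when `B`, `B^∨` are dual bases (both expansions are integral). [folklore] -/
theorem coe_mem_dualLattice_of_biorth
    (hb : ∀ i j, ⟪((bΛ i : Λ) : E), ((bL j : L) : E)⟫_ℝ = if i = j then 1 else 0) (κ : Λ) :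
    (κ : E) ∈ dualLattice L := by
  rw [mem_dualLattice]
  intro y hy
  refine ⟨∑ j, bL.repr ⟨y, hy⟩ j * bΛ.repr κ j, ?_⟩
  have hy' : y = ((⟨y, hy⟩ : L) : E) := rfl
  conv_rhs => rw [hy', ← bL.sum_repr ⟨y, hy⟩]
  rw [Submodule.coe_sum, inner_sum]
  push_cast
  refine sum_congr rfl fun j _ => ?_
  rw [← Int.cast_smul_eq_zsmul ℝ, real_inner_smul_right, inner_coe_basis_eq_repr bΛ bL hb κ j]

end Biorth

/-! ### Lemma 3.5 with one digit, finished by Babai -/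

section Digit

variable {E : Type*} [NormedAddCommGroup E] [InnerProductSpace ℝ E]
variable {Λ : Submodule ℤ E} {n : ℕ} (bΛ : Basis (Fin n) ℤ Λ) (q : ℕ) [NeZero q]

/-- `∑ zᵢbᵢ` as `vecOf` of the basis vectors is `B z`. [folklore] -/
theorem vecOf_coe_basis (z : Fin n → ℤ) :
    vecOf (fun i => ((bΛ i : Λ) : E)) z = ((bΛ.equivFun.symm z : Λ) : E) := by
  rw [vecOf, Basis.equivFun_symm_apply, Submodule.coe_sum]
  refine sum_congr rfl fun i _ => ?_
  rw [Submodule.coe_smul_of_tower, ← Int.cast_smul_eq_zsmul ℝ]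

/-- LOCAL GLUE. **Lemma 3.5 with one digit**: from the candidate secret `s ∈ ℤ_qⁿ` (lifted to
`s̃ᵢ = val sᵢ ∈ ℤ`) pass to `x₁ = (x - B s̃)/q`, run Babai's nearest-plane algorithm on `B` at `x₁`
(output `z₁ ∈ ℤⁿ`), and return `q·z₁ + s̃` — the `B`-coordinates of the purported closest vector
(Regev: "`x_{i+1} = (xᵢ - L(aᵢ mod p))/p` … `aᵢ = p·a_{i+1} + (aᵢ mod p)`", with Babai as the base case).
[cite: RegevLWE2009, Lemma 3.5 (proof)] -/
def digitOutput (x : E) (s : Fin n → ZMod q) : Fin n → ℤ := fun i =>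
  (q : ℤ) * Babai.nearestPlane n (fun i => ((bΛ i : Λ) : E))
      ((q : ℝ)⁻¹ • (x - ((bΛ.equivFun.symm fun i => ((s i).val : ℤ) : Λ) : E))) i +
    ((s i).val : ℤ)

/-- **Correctness of the digit step** (Regev 2009, Lemma 3.5, one level): if the candidate is the
true `B⁻¹κ mod q` and `‖x - κ‖/q < ‖b̃ᵢ‖/2` for every Gram–Schmidt vector of `B`, then
`digitOutput = B⁻¹κ` exactly: `κ - B s̃ = q·κ₁` with `κ₁ ∈ Λ`, `x₁ - κ₁ = (x - κ)/q`, and Babai recovers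
`κ₁` (`Babai.nearestPlane_vecOf_add_of_norm_lt`). [cite: RegevLWE2009, Lemma 3.5 (proof); Babai1986, §3] -/
theorem digitOutput_eq_repr (x : E) (κ : Λ)
    (hGS : ∀ i, InnerProductSpace.gramSchmidt ℝ (fun i => ((bΛ i : Λ) : E)) i ≠ 0)
    (hx : ∀ i, ‖x - κ‖ / q < ‖InnerProductSpace.gramSchmidt ℝ (fun i => ((bΛ i : Λ) : E)) i‖ / 2) :
    digitOutput bΛ q x (fun i => ((bΛ.repr κ i : ℤ) : ZMod q)) = fun i => bΛ.repr κ i := by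
  set r : Fin n → ℤ := fun i => ((((bΛ.repr κ i : ℤ) : ZMod q)).val : ℤ) with hr
  have hdvd : ∀ i, (q : ℤ) ∣ bΛ.repr κ i - r i := fun i => dvd_repr_sub_val bΛ q κ i
  obtain ⟨-, h2⟩ := coe_sub_eq_smul_and_repr bΛ q κ r hdvd
  set κ₁ : Λ := bΛ.equivFun.symm fun i => (bΛ.repr κ i - r i) / q with hκ₁
  set x₁ : E := (q : ℝ)⁻¹ • (x - ((bΛ.equivFun.symm r : Λ) : E)) with hx₁
  -- `x₁ = B(B⁻¹κ₁) + (x - κ)/q`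
  have hsplit : x₁ = vecOf (fun i => ((bΛ i : Λ) : E)) (fun i => bΛ.repr κ₁ i) + (q : ℝ)⁻¹ • (x - κ) := by
    rw [← inv_smul_sub_sub_eq bΛ q x κ r hdvd, vecOf_coe_basis]
    have : (bΛ.equivFun.symm fun i => bΛ.repr κ₁ i) = κ₁ := by
      rw [show (fun i => bΛ.repr κ₁ i) = bΛ.equivFun κ₁ from rfl, LinearEquiv.symm_apply_apply]
    rw [this, hx₁, hκ₁]
    abel
  have hnorm : ‖(q : ℝ)⁻¹ • (x - κ)‖ = ‖x - κ‖ / q := by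
    rw [norm_smul, norm_inv, Real.norm_natCast, inv_mul_eq_div]
  have hbabai : Babai.nearestPlane n (fun i => ((bΛ i : Λ) : E)) x₁ = fun i => bΛ.repr κ₁ i := by
    rw [hsplit]
    exact Babai.nearestPlane_vecOf_add_of_norm_lt _ hGS _ _ fun i => by rw [hnorm]; exact hx i
  funext i
  change (q : ℤ) * Babai.nearestPlane n (fun i => ((bΛ i : Λ) : E)) x₁ i + r i = bΛ.repr κ i
  rw [hbabai, h2 i]

end Digit

/-! ### The data of the experiment and its distance to the ideal data -/

/-- `Δ(p ⊗ r, p' ⊗ r') ≤ Δ(p, p') + Δ(r, r')`. [folklore] -/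
theorem tvDist_prodLaw_le {A B : Type*} (p p' : PMF A) (r r' : PMF B) :
    (prodLaw p r).tvDist (prodLaw p' r') ≤ p.tvDist p' + r.tvDist r' :=
  PMF.tvDist_bind_bind_le p p' _ _ fun a => PMF.tvDist_map_le_holds (Prod.mk a) r r'

section IntegerNoise

variable {E : Type*} [NormedAddCommGroup E] [InnerProductSpace ℝ E]
variable {L : Submodule ℤ E} {n : ℕ} (bL : Basis (Fin n) ℤ L) (q K : ℕ) [NeZero q] [NeZero K]

/-- **The fine manufactured sample with integer noise** (twin of
`Regev2009.bddLWESampleOf_eq_bind_floorGaussian` at modulus `qK`): if `N` is even and `N·⟨x, v⟩ ∈ ℤ` on the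
sampled lattice, then `bddLWESampleFineOf b q K D x α₀ = D.bind (v ↦ (floorGaussian (qK·N) α₀).map
(j ↦ (L⁻¹v mod q, ((K·N⟨x,v⟩ + j + N/2) div N) mod qK)))` (the grid point `⟨x,v⟩/q` sits at
`K·N⟨x,v⟩` on the scale `qK·N`). [cite: RegevLWE2009, Lemma 3.11 (proof, Eq. (10))] -/
theorem bddLWESampleFineOf_eq_bind_floorGaussian (D : PMF L) (x : E) (α₀ : ℝ) {N : ℕ} (hN : 2 ∣ N)
    (hN0 : 0 < N) (num : L → ℤ) (hnum : ∀ v : L, (N : ℝ) * ⟪x, (v : E)⟫_ℝ = num v) :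
    bddLWESampleFineOf bL q K D x α₀ = D.bind fun v =>
      (floorGaussian (q * K * N) α₀).map fun j : ℤ =>
        (coeffMod bL q v, ((((K : ℤ) * num v + j + (N / 2 : ℕ)) / (N : ℤ) : ℤ) : ZMod (q * K))) := by
  unfold bddLWESampleFineOf
  refine congrArg _ (funext fun v => ?_)
  have hk : ((q * K * N : ℕ) : ℝ) * (⟪x, (v : E)⟫_ℝ / q) = ((K : ℤ) * num v : ℤ) := by
    have hq : (q : ℝ) ≠ 0 := NeZero.ne (q : ℝ)
    push_cast
    rw [← hnum v]
    field_simp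
  rw [noiseZMod_eq_map_floorGaussian (q * K) hN hN0 α₀ (⟪x, (v : E)⟫_ℝ / q) ((K : ℤ) * num v) hk,
    PMF.map_comp]
  rfl

end IntegerNoise

section Data

variable {E : Type*} [NormedAddCommGroup E] [InnerProductSpace ℝ E] [FiniteDimensional ℝ E]
  [MeasurableSpace E] [BorelSpace E]
variable {L : Submodule ℤ E} [DiscreteTopology L] [IsZLattice ℝ L]
variable {n : ℕ} (bL : Basis (Fin n) ℤ L) (q K : ℕ) [NeZero q] [NeZero K] (m NV Kg J : ℕ)

/-- LOCAL GLUE. The Gaussian parameter of the COARSE manufactured samples of block `j = (k, i)`: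
`√((α/√2)² + k·α²/K_g)` — Regev's noise `e` of parameter `α/√2` (standard deviation `α/(2√π)`) plus the
independent padding noise of Lemma 3.7 with variance parameter `k·α²/K_g`, folded into one Gaussian.
[cite: RegevLWE2009, Lemma 3.11 (proof: "`e` … with standard deviation `α/(2√π)`") and Lemma 3.7 (proof)] -/
def padNoise (α : ℝ) (Kg J : ℕ) (j : Fin ((Kg + 1) * J)) : ℝ :=
  Real.sqrt ((α / Real.sqrt 2) ^ 2 + ((finProdFinEquiv.symm j).1 : ℕ) * (α ^ 2 / Kg))

/-- `padNoise ≥ α/√2 > 0`. [folklore] -/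
theorem div_sqrt_two_le_padNoise {α : ℝ} (hα : 0 ≤ α) (Kg J : ℕ) (j : Fin ((Kg + 1) * J)) :
    α / Real.sqrt 2 ≤ padNoise α Kg J j := by
  unfold padNoise
  calc α / Real.sqrt 2 = Real.sqrt ((α / Real.sqrt 2) ^ 2) := (Real.sqrt_sq (by positivity)).symm
    _ ≤ _ := Real.sqrt_le_sqrt (le_add_of_nonneg_right (by positivity))

/-- The width bookkeeping: `(r‖x'‖/q)² + padNoise² = β² + k·α²/K_g` with `β² = (r‖x'‖/q)² + α²/2`, i.e.
the ideal coarse noise of block `j` is `Ψ̄_{levelNoise α β K_g J j}`. [folklore] -/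
theorem sqrt_sq_add_padNoise_sq (t α : ℝ) (Kg J : ℕ) (j : Fin ((Kg + 1) * J)) :
    Real.sqrt (t ^ 2 + padNoise α Kg J j ^ 2) =
      levelNoise α (Real.sqrt (t ^ 2 + (α / Real.sqrt 2) ^ 2)) Kg J j := by
  unfold padNoise levelNoise
  rw [Real.sq_sqrt (by positivity), Real.sq_sqrt (by positivity), add_assoc]

/-- LOCAL GLUE. **The law of the data of block `j`** as the reduction samples it: a uniform shift, `m`
coarse manufactured samples `(L⁻¹v mod q, ⌊q(⟨x,v⟩/q + e)⌉ mod q)` with `e ∼ N(0, padNoise²/(2π))`, and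
`N_V` fine manufactured samples (parameter `α/√2`), all from independent lattice samples `v ← D`.
[cite: RegevLWE2009, Lemma 3.11 (proof) with Lemma 3.7 (proof) and Lemma 4.1 (proof)] -/
def realBlockLaw (D : PMF L) (x : E) (α : ℝ) (j : Fin ((Kg + 1) * J)) :
    PMF (((Fin n → ZMod q) × (Fin m → (Fin n → ZMod q) × ZMod q)) ×
      (Fin NV → (Fin n → ZMod q) × ZMod (q * K))) :=
  prodLaw (prodLaw (PMF.uniformOfFintype (Fin n → ZMod q))
      (iidPMF (bddLWESampleOf bL q D x (padNoise α Kg J j)) m))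
    (iidPMF (bddLWESampleFineOf bL q K D x (α / Real.sqrt 2)) NV)

/-- LOCAL GLUE. The law of the whole data: the `(K_g+1)·J` blocks are independent. [cite: RegevLWE2009, Lemma 3.7 (proof)] -/
def regevData (D : PMF L) (x : E) (α : ℝ) :
    PMF (Fin ((Kg + 1) * J) → ((Fin n → ZMod q) × (Fin m → (Fin n → ZMod q) × ZMod q)) ×
      (Fin NV → (Fin n → ZMod q) × ZMod (q * K))) :=
  indepLaw ((Kg + 1) * J) (realBlockLaw bL q K m NV Kg J D x α)

/-- **One block of data is `(m + N_V)(δ + 6ε)`-close to the ideal block** `blockLaw` with coarse noise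
`Ψ̄_{levelNoise j}`, fine noise `Ψ̄^{(qK)}_β`, secret `s = secretOf B^∨ q κ`
(`β = √((r‖x-κ‖/q)² + α²/2)`), under the hypotheses of Lemma 3.11 (`0 < ε ≤ 1/2`, `√2·q·η_ε(L) ≤ r`,
`κ ∈ L*`, `r‖x - κ‖ ≤ (α/√2)q`) and `Δ(D, D_{L,r}) ≤ δ`. [cite: RegevLWE2009, Lemma 3.11 (proof) with Lemma 3.7 (proof)] -/
theorem tvDist_realBlockLaw_blockLaw_le (D : PMF L) {δ ε r α : ℝ} (hD : D.tvDist (discreteGaussian L r 0) ≤ δ)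
    (hε : 0 < ε) (hε' : ε ≤ 1 / 2) (hr : 0 < r) (hα : 0 < α)
    (hη : Real.sqrt 2 * q * smoothingParameter L ε ≤ r) {x κ : E} (hκ : κ ∈ dualLattice L)
    (hx : r * ‖x - κ‖ ≤ α / Real.sqrt 2 * q) (j : Fin ((Kg + 1) * J)) :
    (realBlockLaw bL q K m NV Kg J D x α j).tvDist
      (blockLaw q K m NV
        (discretizedGaussian q (levelNoise α (Real.sqrt ((r * ‖x - κ‖ / q) ^ 2 + (α / Real.sqrt 2) ^ 2)) Kg J j))
        (discretizedGaussian (q * K) (Real.sqrt ((r * ‖x - κ‖ / q) ^ 2 + (α / Real.sqrt 2) ^ 2)))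
        (secretOf bL q κ)) ≤ (m + NV) * (δ + 6 * ε) := by
  have hα2 : 0 < α / Real.sqrt 2 := by positivity
  have hpad : 0 < padNoise α Kg J j := hα2.trans_le (div_sqrt_two_le_padNoise hα.le Kg J j)
  have hxj : r * ‖x - κ‖ ≤ padNoise α Kg J j * q :=
    hx.trans (mul_le_mul_of_nonneg_right (div_sqrt_two_le_padNoise hα.le Kg J j) (Nat.cast_nonneg q))
  unfold realBlockLaw blockLaw
  refine (tvDist_prodLaw_le _ _ _ _).trans ?_
  have h1 := tvDist_iidPMF_bddLWESampleOf_lweSamples_le bL q D hD hε hε' hr hpad hη hκ hxj m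
  rw [sqrt_sq_add_padNoise_sq] at h1
  have h2 := tvDist_iidPMF_bddLWESampleFineOf_le bL q K D hD hε hε' hr hα2 hη hκ hx NV
  have h0 : (prodLaw (PMF.uniformOfFintype (Fin n → ZMod q))
      (iidPMF (bddLWESampleOf bL q D x (padNoise α Kg J j)) m)).tvDist
      (prodLaw (PMF.uniformOfFintype (Fin n → ZMod q))
        (lweSamples (discretizedGaussian q
          (levelNoise α (Real.sqrt ((r * ‖x - κ‖ / q) ^ 2 + (α / Real.sqrt 2) ^ 2)) Kg J j))
          (secretOf bL q κ) m)) ≤ m * (δ + 6 * ε) := by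
    refine (tvDist_prodLaw_le _ _ _ _).trans ?_
    rw [PMF.tvDist_self, zero_add]
    exact h1
  calc _ ≤ m * (δ + 6 * ε) + NV * (δ + 6 * ε) := add_le_add h0 h2
    _ = (m + NV) * (δ + 6 * ε) := by ring

/-- **The whole data is `(K_g+1)J(m+N_V)(δ+6ε)`-close to the ideal data** (`tvDist_indepLaw_le`).
[cite: RegevLWE2009, Lemma 3.11 (proof) with Lemma 3.7 (proof)] -/
theorem tvDist_regevData_le (D : PMF L) {δ ε r α : ℝ} (hD : D.tvDist (discreteGaussian L r 0) ≤ δ)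
    (hε : 0 < ε) (hε' : ε ≤ 1 / 2) (hr : 0 < r) (hα : 0 < α)
    (hη : Real.sqrt 2 * q * smoothingParameter L ε ≤ r) {x κ : E} (hκ : κ ∈ dualLattice L)
    (hx : r * ‖x - κ‖ ≤ α / Real.sqrt 2 * q) :
    (regevData bL q K m NV Kg J D x α).tvDist
      (indepLaw ((Kg + 1) * J) fun j => blockLaw q K m NV
        (discretizedGaussian q (levelNoise α (Real.sqrt ((r * ‖x - κ‖ / q) ^ 2 + (α / Real.sqrt 2) ^ 2)) Kg J j))
        (discretizedGaussian (q * K) (Real.sqrt ((r * ‖x - κ‖ / q) ^ 2 + (α / Real.sqrt 2) ^ 2)))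
        (secretOf bL q κ)) ≤ ((Kg + 1) * J : ℕ) * ((m + NV) * (δ + 6 * ε)) := by
  unfold regevData
  refine (tvDist_indepLaw_le _ _ _).trans ?_
  calc ∑ j, (realBlockLaw bL q K m NV Kg J D x α j).tvDist _
      ≤ ∑ _j : Fin ((Kg + 1) * J), (m + NV) * (δ + 6 * ε) :=
        sum_le_sum fun j _ => tvDist_realBlockLaw_blockLaw_le bL q K m NV Kg J D hD hε hε' hr hα hη hκ hx j
    _ = ((Kg + 1) * J : ℕ) * ((m + NV) * (δ + 6 * ε)) := by
        rw [sum_const, card_univ, Fintype.card_fin, nsmul_eq_mul]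

/-! ### The same data with integer noise samples -/

/-- LOCAL GLUE. The law of the data of block `j` written with INTEGER noise samples: `v ← D`,
`i ← floorGaussian (q·N) (padNoise)` resp. `floorGaussian (qK·N) (α/√2)`, and the explicit integer maps of
`RegevBDDIntegerNoise.lean` (the target `x` enters only through `num v = N⟨x, v⟩ ∈ ℤ`). [cite: RegevLWE2009, Lemma 3.11 (proof, Eq. (10)) — integer arithmetic form] -/
def realBlockLawInt (D : PMF L) (α : ℝ) (N : ℕ) (num : L → ℤ) (j : Fin ((Kg + 1) * J)) :
    PMF (((Fin n → ZMod q) × (Fin m → (Fin n → ZMod q) × ZMod q)) ×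
      (Fin NV → (Fin n → ZMod q) × ZMod (q * K))) :=
  prodLaw (prodLaw (PMF.uniformOfFintype (Fin n → ZMod q))
      (iidPMF (D.bind fun v => (floorGaussian (q * N) (padNoise α Kg J j)).map fun i : ℤ =>
        (coeffMod bL q v, (((num v + i + (N / 2 : ℕ)) / (N : ℤ) : ℤ) : ZMod q))) m))
    (iidPMF (D.bind fun v => (floorGaussian (q * K * N) (α / Real.sqrt 2)).map fun i : ℤ =>
        (coeffMod bL q v, ((((K : ℤ) * num v + i + (N / 2 : ℕ)) / (N : ℤ) : ℤ) : ZMod (q * K)))) NV)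

omit [FiniteDimensional ℝ E] [MeasurableSpace E] [BorelSpace E] [DiscreteTopology L] [IsZLattice ℝ L] in
/-- **The block law IS the integer-noise block law** (`N` even, `N⟨x, v⟩ ∈ ℤ` on the sampled lattice).
[cite: RegevLWE2009, Lemma 3.11 (proof, Eq. (10))] -/
theorem realBlockLaw_eq_realBlockLawInt (D : PMF L) (x : E) (α : ℝ) {N : ℕ} (hN : 2 ∣ N) (hN0 : 0 < N)
    (num : L → ℤ) (hnum : ∀ v : L, (N : ℝ) * ⟪x, (v : E)⟫_ℝ = num v) (j : Fin ((Kg + 1) * J)) :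
    realBlockLaw bL q K m NV Kg J D x α j = realBlockLawInt bL q K m NV Kg J D α N num j := by
  unfold realBlockLaw realBlockLawInt
  rw [bddLWESampleOf_eq_bind_floorGaussian bL q D x _ hN hN0 num hnum,
    bddLWESampleFineOf_eq_bind_floorGaussian bL q K D x _ hN hN0 num hnum]

/-- LOCAL GLUE. The law of the whole data with integer noise samples. [cite: RegevLWE2009, Lemma 3.7 (proof)] -/
def regevDataInt (D : PMF L) (α : ℝ) (N : ℕ) (num : L → ℤ) :
    PMF (Fin ((Kg + 1) * J) → ((Fin n → ZMod q) × (Fin m → (Fin n → ZMod q) × ZMod q)) ×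
      (Fin NV → (Fin n → ZMod q) × ZMod (q * K))) :=
  indepLaw ((Kg + 1) * J) (realBlockLawInt bL q K m NV Kg J D α N num)

omit [FiniteDimensional ℝ E] [MeasurableSpace E] [BorelSpace E] [DiscreteTopology L] [IsZLattice ℝ L] in
/-- **`regevData = regevDataInt`**: the data of the idealised reduction needs no real-valued draw.
[cite: RegevLWE2009, Lemma 3.11 (proof, Eq. (10))] -/
theorem regevData_eq_regevDataInt (D : PMF L) (x : E) (α : ℝ) {N : ℕ} (hN : 2 ∣ N) (hN0 : 0 < N)
    (num : L → ℤ) (hnum : ∀ v : L, (N : ℝ) * ⟪x, (v : E)⟫_ℝ = num v) :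
    regevData bL q K m NV Kg J D x α = regevDataInt bL q K m NV Kg J D α N num := by
  unfold regevData regevDataInt
  exact congrArg _ (funext fun j => realBlockLaw_eq_realBlockLawInt bL q K m NV Kg J D x α hN hN0 num hnum j)

end Data

/-! ### The experiment and its success bound -/

section Experiment

variable {E : Type*} [NormedAddCommGroup E] [InnerProductSpace ℝ E] [FiniteDimensional ℝ E]
  [MeasurableSpace E] [BorelSpace E]
variable {Λ L : Submodule ℤ E} [DiscreteTopology L] [IsZLattice ℝ L]
variable {n : ℕ} (bΛ : Basis (Fin n) ℤ Λ) (bL : Basis (Fin n) ℤ L) (q K : ℕ) [NeZero q] [NeZero K]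
  (m NV Kg J : ℕ)

/-- LOCAL GLUE. **Regev's classical `BDD → LWE` reduction, idealised** (Lemma 3.4 = Peikert's Prop. 3.2,
everything except the machine): draw the data (`regevData`: `(K_g+1)·J` blocks of a uniform shift,
`m` coarse and `N_V` fine manufactured `LWE` samples from the lattice sampler `D` and the target `x`),
find the secret by `firstAccepted` (oracle `F`, threshold `θ_α`), and apply the digit/Babai step on
the basis `B` of `Λ`; output the `B`-coordinates found, or `none`. [cite: RegevLWE2009, Lemma 3.4 (proof = §3.2.1); Peikert2009, Prop. 3.2] -/
def regevBDD (D : PMF L) (x : E) (α : ℝ) (F : (Fin m → (Fin n → ZMod q) × ZMod q) → Fin n → ZMod q)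
    (Acc : (Fin n → ZMod q) → Set (Fin NV → (Fin n → ZMod q) × ZMod (q * K))) :
    PMF (Option (Fin n → ℤ)) :=
  (regevData bL q K m NV Kg J D x α).map fun data =>
    (firstAccepted q K m NV F Acc data).map (digitOutput bΛ q x)

omit [FiniteDimensional ℝ E] [MeasurableSpace E] [BorelSpace E] [DiscreteTopology L] [IsZLattice ℝ L] in
/-- **`regevBDD` from the integer-noise data**: with `N` even and `N⟨x, v⟩ ∈ ℤ` on `L`, the experiment is
the image of `regevDataInt` (all draws discrete: lattice samples, integer Gaussians, uniform shifts) under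
the deterministic decision `firstAccepted` followed by `digitOutput` — the law a machine with exact samplers
realises on the nose. [cite: RegevLWE2009, Lemma 3.4 (proof = §3.2.1); Peikert2009, Prop. 3.2] -/
theorem regevBDD_eq_map_regevDataInt (D : PMF L) (x : E) (α : ℝ)
    (F : (Fin m → (Fin n → ZMod q) × ZMod q) → Fin n → ZMod q)
    (Acc : (Fin n → ZMod q) → Set (Fin NV → (Fin n → ZMod q) × ZMod (q * K))) {N : ℕ} (hN : 2 ∣ N)
    (hN0 : 0 < N) (num : L → ℤ) (hnum : ∀ v : L, (N : ℝ) * ⟪x, (v : E)⟫_ℝ = num v) :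
    regevBDD bΛ bL q K m NV Kg J D x α F Acc = (regevDataInt bL q K m NV Kg J D α N num).map fun data =>
      (firstAccepted q K m NV F Acc data).map (digitOutput bΛ q x) := by
  rw [regevBDD, regevData_eq_regevDataInt bL q K m NV Kg J D x α hN hN0 num hnum]

/-- **Regev 2009, Lemma 3.4 / Peikert 2009, Prop. 3.2 — the success bound of the idealised
reduction.** Let `B` be a `ℤ`-basis of `Λ` and `B^∨` the dual `ℤ`-basis of `L` (`⟪bᵢ, b^∨ⱼ⟫ = δᵢⱼ`,
so `L = Λ*`), `0 < ε ≤ 1/2`, `0 < r` with `√2·q·η_ε(L) ≤ r`, `0 < α`, a lattice sampler `D` with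
`Δ(D, D_{L,r}) ≤ δ`, a target `x` and `κ ∈ Λ` with `r‖x - κ‖ ≤ (α/√2)·q` (Regev: `dist(x, Λ) ≤ αq/(√2 r)`)
and `‖x - κ‖/q < ‖b̃ᵢ‖/2` for all `i` (one digit suffices), an oracle `F` solving `LWE_{q,Ψ̄_α}` from `m`
samples with AVERAGE-case probability `≥ 2/3`, and parameters `K_g ≥ max(1, 24m)`, `4πe^{πα²} ≤ qK`,
`e^{-N_V e^{-2πα²}/128} ≤ 1/7`. Then
`Pr[regevBDD ≠ some (B⁻¹κ)] ≤ (K_g+1)J(m+N_V)(δ+6ε) + (K_g+1)J·e^{-N_V e^{-2πα²}/32} + 2^{-J}`.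
[cite: RegevLWE2009, Lemma 3.4 with Lemmas 3.5, 3.6, 3.7, 3.11 and Lemma 4.1 (proof); Peikert2009, Prop. 3.2] -/
theorem toReal_regevBDD_ne_le
    (hb : ∀ i j, ⟪((bΛ i : Λ) : E), ((bL j : L) : E)⟫_ℝ = if i = j then 1 else 0)
    (D : PMF L) {δ ε r α : ℝ} (hD : D.tvDist (discreteGaussian L r 0) ≤ δ)
    (hε : 0 < ε) (hε' : ε ≤ 1 / 2) (hr : 0 < r) (hα : 0 < α)
    (hη : Real.sqrt 2 * q * smoothingParameter L ε ≤ r) (x : E) (κ : Λ)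
    (hx : r * ‖x - κ‖ ≤ α / Real.sqrt 2 * q)
    (hGS : ∀ i, InnerProductSpace.gramSchmidt ℝ (fun i => ((bΛ i : Λ) : E)) i ≠ 0)
    (hxB : ∀ i, ‖x - κ‖ / q < ‖InnerProductSpace.gramSchmidt ℝ (fun i => ((bΛ i : Λ) : E)) i‖ / 2)
    (F : (Fin m → (Fin n → ZMod q) × ZMod q) → Fin n → ZMod q)
    (hF : ENNReal.ofReal (2 / 3) ≤ searchSuccessProb (discretizedGaussian q α) m fun B => PMF.pure (F B))
    (hKg : 24 * m ≤ Kg) (hKg1 : 1 ≤ Kg)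
    (Acc : (Fin n → ZMod q) → Set (Fin NV → (Fin n → ZMod q) × ZMod (q * K))) {ηA ηR : ℝ} (hηA : 0 ≤ ηA)
    (hAcc : ∀ β' : ℝ, 0 < β' → β' ≤ α → ∀ s' : Fin n → ZMod q,
      (∀ c, c ≠ s' → ((iidPMF (lweSampleK q K (discretizedGaussian (q * K) β') s') NV).toOuterMeasure
        (Acc c)).toReal ≤ ηA) ∧
      ((iidPMF (lweSampleK q K (discretizedGaussian (q * K) β') s') NV).toOuterMeasure (Acc s')ᶜ).toReal ≤ ηR)
    (hηR7 : ηR ≤ 1 / 7) :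
    ((regevBDD bΛ bL q K m NV Kg J D x α F Acc).toOuterMeasure {o | o ≠ some (fun i => bΛ.repr κ i)}).toReal ≤
      ((Kg + 1) * J : ℕ) * ((m + NV) * (δ + 6 * ε)) + (((Kg + 1) * J : ℕ) * ηA + (1 / 2) ^ J) := by
  have hκL : (κ : E) ∈ dualLattice L := coe_mem_dualLattice_of_biorth bΛ bL hb κ
  set s : Fin n → ZMod q := secretOf bL q (κ : E) with hs
  have hsecret : s = fun i => ((bΛ.repr κ i : ℤ) : ZMod q) := secretOf_eq_of_biorth bΛ bL q hb κ
  set β : ℝ := Real.sqrt ((r * ‖x - (κ : E)‖ / q) ^ 2 + (α / Real.sqrt 2) ^ 2) with hβ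
  -- `0 < β ≤ α`
  have hα2 : 0 < α / Real.sqrt 2 := by positivity
  have hβpos : 0 < β := by
    refine lt_of_lt_of_le hα2 ?_
    calc α / Real.sqrt 2 = Real.sqrt ((α / Real.sqrt 2) ^ 2) := (Real.sqrt_sq hα2.le).symm
      _ ≤ β := Real.sqrt_le_sqrt (le_add_of_nonneg_left (sq_nonneg _))
  have hβα : β ≤ α := by
    have h := noiseParam_le q hα2 hx (mul_nonneg hr.le (norm_nonneg _))
    rwa [mul_div_cancel₀ _ (Real.sqrt_ne_zero'.2 two_pos)] at h
  -- the ideal data and its failure bound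
  set P := indepLaw ((Kg + 1) * J) fun j => blockLaw q K m NV
    (discretizedGaussian q (levelNoise α β Kg J j)) (discretizedGaussian (q * K) β) s with hP
  obtain ⟨hA, hR⟩ := hAcc β hβpos hβα s
  have hideal := toReal_firstAccepted_ne_le_grid_simple q K m NV (J := J) hKg hKg1 hβpos hβα s F hF Acc hηA
    hA hR hηR7
  -- the data is close to the ideal data
  have htv := tvDist_regevData_le bL q K m NV Kg J D hD hε hε' hr hα hη hκL hx
  -- the output fails only if the secret was not found
  set A : Set (Fin ((Kg + 1) * J) → ((Fin n → ZMod q) × (Fin m → (Fin n → ZMod q) × ZMod q)) ×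
      (Fin NV → (Fin n → ZMod q) × ZMod (q * K))) :=
    {data | firstAccepted q K m NV F Acc data ≠ some s} with hA
  have hsub : (fun data => (firstAccepted q K m NV F Acc data).map (digitOutput bΛ q x)) ⁻¹'
      {o : Option (Fin n → ℤ) | o ≠ some (fun i => bΛ.repr κ i)} ⊆ A := by
    intro data hdata hfa
    apply hdata
    simp only [hfa, Option.map_some, hsecret]
    rw [digitOutput_eq_repr bΛ q x κ hGS hxB]
  rw [regevBDD, PMF.toOuterMeasure_map_apply]
  calc ((regevData bL q K m NV Kg J D x α).toOuterMeasure _).toReal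
      ≤ ((regevData bL q K m NV Kg J D x α).toOuterMeasure A).toReal :=
        ENNReal.toReal_mono (pmf_toOuterMeasure_ne_top _ _) (OuterMeasure.mono _ hsub)
    _ ≤ (P.toOuterMeasure A).toReal + (regevData bL q K m NV Kg J D x α).tvDist P := by
        have h := PMF.abs_toReal_toOuterMeasure_sub_le_tvDist (regevData bL q K m NV Kg J D x α) P A
        rw [abs_le] at h
        linarith [h.2]
    _ ≤ (((Kg + 1) * J : ℕ) * ηA + (1 / 2) ^ J) + ((Kg + 1) * J : ℕ) * ((m + NV) * (δ + 6 * ε)) :=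
        add_le_add hideal htv
    _ = _ := by ring

/-- **The instance with Regev's cosine test** (`Acc = acceptSet q K N_V θ_α`, `4πe^{πα²} ≤ qK`,
`e^{-N_V e^{-2πα²}/128} ≤ 1/7`; `RegevVerificationTest.lean`):
`Pr[regevBDD ≠ some (B⁻¹κ)] ≤ (K_g+1)J(m+N_V)(δ+6ε) + (K_g+1)J·e^{-N_V e^{-2πα²}/32} + 2^{-J}`.
[cite: RegevLWE2009, Lemma 3.4 with Lemmas 3.5, 3.6, 3.7, 3.11 and Lemma 4.1 (proof); Peikert2009, Prop. 3.2] -/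
theorem toReal_regevBDD_ne_le_cos
    (hb : ∀ i j, ⟪((bΛ i : Λ) : E), ((bL j : L) : E)⟫_ℝ = if i = j then 1 else 0)
    (D : PMF L) {δ ε r α : ℝ} (hD : D.tvDist (discreteGaussian L r 0) ≤ δ)
    (hε : 0 < ε) (hε' : ε ≤ 1 / 2) (hr : 0 < r) (hα : 0 < α)
    (hη : Real.sqrt 2 * q * smoothingParameter L ε ≤ r) (x : E) (κ : Λ)
    (hx : r * ‖x - κ‖ ≤ α / Real.sqrt 2 * q)
    (hGS : ∀ i, InnerProductSpace.gramSchmidt ℝ (fun i => ((bΛ i : Λ) : E)) i ≠ 0)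
    (hxB : ∀ i, ‖x - κ‖ / q < ‖InnerProductSpace.gramSchmidt ℝ (fun i => ((bΛ i : Λ) : E)) i‖ / 2)
    (F : (Fin m → (Fin n → ZMod q) × ZMod q) → Fin n → ZMod q)
    (hF : ENNReal.ofReal (2 / 3) ≤ searchSuccessProb (discretizedGaussian q α) m fun B => PMF.pure (F B))
    (hKg : 24 * m ≤ Kg) (hKg1 : 1 ≤ Kg) (hqK : 4 * π * Real.exp (π * α ^ 2) ≤ (q * K : ℕ))
    (hNV : Real.exp (-(NV * Real.exp (-(2 * π * α ^ 2)) / 128)) ≤ 1 / 7) :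
    ((regevBDD bΛ bL q K m NV Kg J D x α F (acceptSet q K NV (threshold α))).toOuterMeasure
        {o | o ≠ some (fun i => bΛ.repr κ i)}).toReal ≤
      ((Kg + 1) * J : ℕ) * ((m + NV) * (δ + 6 * ε)) +
        (((Kg + 1) * J : ℕ) * Real.exp (-(NV * Real.exp (-(2 * π * α ^ 2)) / 32)) + (1 / 2) ^ J) :=
  toReal_regevBDD_ne_le bΛ bL q K m NV Kg J hb D hD hε hε' hr hα hη x κ hx hGS hxB F hF hKg hKg1 _
    (Real.exp_pos _).le (fun β' hβ' hβ'α s' =>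
      ⟨fun c hc => toReal_accept_of_ne_le_exp q K α β' hc NV,
       toReal_reject_self_le_exp q K (by rw [abs_of_pos hβ']; exact hβ'α) hqK s' NV⟩) hNV

end Experiment

end Regev2009

end Literature.Computability.Cryptography
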